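import Mathlib
import HarnessLib
import Summits.HubbardSuperconductivity.HubbardSuperconductivity.Theorems.KLProgrammeKLRegimeSplitPhValueSignBlind
import Summits.HubbardSuperconductivity.HubbardSuperconductivity.Theorems.KLProgrammeKLRegimeSplitPhValueDiagonal

/-!
# Route `KLProgramme` — ENGINE (stmt-HubbardSuperconductivity-20437 `KLRegimeEngineV17F2`), row (c) binder #8 (★ v19 `hexLadMV`), value rows `RP` / `RQ` SIGN-BLIND IN THE ROWS DOOR'S
# LITERAL SHAPE AT EVERY PIN `(x, y, Qm)` — brick O6j′ (sequel of O6j, which sits at the diagonals `y = x` / `Qm = x + y`)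
# (cell gate-hubbard-kl, seat hubbard-kl-k3c2-p2 g32, technique «thermal-bar induction n ≤ nScales β + 1 with EngineBoundsAtV4S sums»)

WHY.  The rows door `klmd_defect_le_rows_family` takes `hP` / `hQ` at every pinned pair `(x, y)` and class momentum `Qm`; off the diagonals the partner label is translated in momentum
(`p′ = (p.1, p.2 + x − y)` for RP after O6f `klph_directRow_eq`; `p′ = (σ p.1, p.2 + Qm − x − y)` for RQ after O6g `klph_exchangeRow_eq`).  A momentum translation is a BIJECTION of
the label set, so the sign-blind born mass is unchanged: hard line `‖Ẇ_tβL²ĝ‖ ≤ βL²(128/3)/Λ(t)²` at every label, soft sum `Σ_p‖Φ_jβL²ĝ‖ ≤ βL²·15367Λₙ·βL²` re-indexed by the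
translation (`klph_sum_mshift_norm_reindex`) and, for RQ, by the Matsubara shift (O6j `klph_sum_shift_reindex_real`), slice ratio `≤ 12`.

* `klph_sum_mshift_norm_reindex` — `Σ_p f (p.1, p.2 + q) = Σ_p f p` for real `f`.
* **`klph_directRow_signBlind_le`** — RP in the door's shape (any `c : ℤ`, `x`, `y`), `‖F p σ p′‖ ≤ F∞`: `(Λₙ−Λₙ₊₁)((βL²)³)⁻¹‖Σ_pΣ_σΣ_{p′}[…]·(…)·F p σ p′‖ ≤ 2¹¹·15367·F∞`
  (two orderings × two spins × the born mass `2⁹·15367`).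
* **`klph_exchangeRow_signBlind_le`** — RQ in the door's shape (any `Qm x y`), `‖F p p′‖ ≤ F∞`: `≤ 2¹⁰·15367·F∞` (no hypothesis on `M`).
By value `F∞ = (c₄U)²` ((E.2)); these are the rows above the p-h plateau and in the last scales (E1-LEDGER line #8; g32/RECIPE §4).  Pure composition; no definitions; nothing asserts
(c), K3 or superconductivity.  [cite: BenfattoGiulianiMastropietro2006, §2.4–§2.5]
-/

noncomputable section

namespace Summit.HubbardSuperconductivity.HubbardSuperconductivity.Theorems.KLRegimeSplit

set_option linter.dupNamespace false -- summit = problem name (single-conjunct summit), D-0017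

open Real Set Finset Literature.MathematicalPhysics.QuantumLattice
open Literature.Probability.LatticeModels hiding torusSupNorm
open Literature.MathematicalPhysics.QuantumLattice.BandSectorCounting
open Summit.HubbardSuperconductivity.HubbardSuperconductivity.Theorems.TwoPointAssembly
open Summit.HubbardSuperconductivity.HubbardSuperconductivity.Theorems.KLProgrammeLegKernels
open Summit.HubbardSuperconductivity.HubbardSuperconductivity.Theorems.KLRegimeWick
open Summit.HubbardSuperconductivity.HubbardSuperconductivity.Theorems.EngineV8
open Summit.HubbardSuperconductivity.HubbardSuperconductivity.Theorems.DispersionFlow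
open Summit.HubbardSuperconductivity.HubbardSuperconductivity.Theorems.PerturbedFermiCurve

variable {L M : ℕ} [NeZero L] [NeZero M]

omit [NeZero M] in
/-- Reindexing a real sum by the momentum translation (a bijection of the labels): `Σ_p f (p.1, p.2 + q) = Σ_p f p`. -/
theorem klph_sum_mshift_norm_reindex (q : TorusSite 2 L) (f : FreqMomentum L M → ℝ) :
    (∑ p : FreqMomentum L M, f (p.1, p.2 + q)) = ∑ p : FreqMomentum L M, f p := by
  let e : FreqMomentum L M ≃ FreqMomentum L M :=
    ⟨fun p => (p.1, p.2 + q), fun p => (p.1, p.2 - q), fun p => by simp, fun p => by simp⟩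
  exact Fintype.sum_equiv e _ _ fun p => rfl

section Door

variable {R : RenConsts} {U : ℝ} {N : ℕ}

omit [NeZero L] [NeZero M] in
/-- Slice arithmetic: `(Λₙ − Λₙ₊₁)·Λₙ/Λ(t)² ≤ 12`. -/
private theorem klph_slice_ratio_le'' (n : ℕ) {t : ℝ} (ht : t ∈ Icc (0 : ℝ) 1) :
    (klScale klE0 n - klScale klE0 (n + 1)) * klScale klE0 n / (klScale klE0 n + t * (klScale klE0 (n + 1) - klScale klE0 n)) ^ 2 ≤ 12 := by
  have h10 := (klmf_klScale_succ_pos_le n).2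
  have h1 := (klmf_klScale_succ_pos_le n).1
  have hΛn : 0 < klScale klE0 n := klth_klScale_pos n
  have hsucc : klScale klE0 (n + 1) = klScale klE0 n / 4 := klth_klScale_succ n
  have hmem := klws_affine_mem_Icc h10 ht
  calc (klScale klE0 n - klScale klE0 (n + 1)) * klScale klE0 n / (klScale klE0 n + t * (klScale klE0 (n + 1) - klScale klE0 n)) ^ 2
      ≤ (klScale klE0 n - klScale klE0 (n + 1)) * klScale klE0 n / (klScale klE0 (n + 1)) ^ 2 :=
        div_le_div_of_nonneg_left (by nlinarith) (by positivity) (pow_le_pow_left₀ h1.le hmem.1 2)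
    _ = 12 := by rw [hsucc]; field_simp; ring

omit [NeZero M] in
/-- **RP SIGN-BLIND IN THE ROWS DOOR'S SHAPE** (any `c : ℤ`, any pinned pair `(x, y)`): on an admissible frame, `klBetaMin ≤ β ≤ L`, member `j ≥ n+1`, `t ∈ [0,1]`, for any partner
kernel `F : FreqMomentum → Fin 2 → FreqMomentum → ℂ` with `‖F p σ p′‖ ≤ F∞`:
`(Λₙ−Λₙ₊₁)((βL²)³)⁻¹‖Σ_pΣ_σΣ_{p′}[p′.1 + c = p.1 + c ∧ p′.2 = p.2 + x − y]·((Φ_jβL²ĝ)(p)(Ẇ_tβL²ĝ)(p′) + (Ẇ_tβL²ĝ)(p)(Φ_jβL²ĝ)(p′))·F p σ p′‖ ≤ 2¹¹·15367·F∞`.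
[cite: BenfattoGiulianiMastropietro2006, §2.4–§2.5] -/
theorem klph_directRow_signBlind_le {β μ : ℝ} {K : TrigPolyC4v} (hK : FrameOK R U N μ K) (hβ : klBetaMin ≤ β) (hβL : β ≤ L)
    (n : ℕ) {t : ℝ} (ht : t ∈ Icc (0 : ℝ) 1)
    (Φ : ℕ → ℝ → FreqMomentum L M → ℝ) (hΦ : Φ = fun j t k => (softSymbolCompl L M β μ K (n + 1) j) k + (hubbardCutoffWeightCT L M β μ K (klScale klE0 (n + 1)) k -
            hubbardCutoffWeightCT L M β μ K (klScale klE0 n + t * (klScale klE0 (n + 1) - klScale klE0 n)) k))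
    (Wd : ℝ → FreqMomentum L M → ℝ) (hWd : Wd = fun t k => deriv (fun Λ' : ℝ => hubbardCutoffWeightCT L M β μ K Λ' k) (klScale klE0 n + t * (klScale klE0 (n + 1) - klScale klE0 n)))
    {j : ℕ} (hj : n + 1 ≤ j)
    (F : FreqMomentum L M → Fin 2 → FreqMomentum L M → ℂ) {Finf : ℝ} (hF0 : 0 ≤ Finf) (hF : ∀ p σ p', ‖F p σ p'‖ ≤ Finf)
    (c : ℤ) (x y : TorusSite 2 L) :
    (klScale klE0 n - klScale klE0 (n + 1)) * ((β * (L : ℝ) ^ 2) ^ 3)⁻¹ *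
      ‖∑ p : FreqMomentum L M, ∑ σ : Fin 2, ∑ p' : FreqMomentum L M,
        (if matsubaraInt M p'.1 + c = matsubaraInt M p.1 + c ∧ p'.2 = p.2 + x - y then
          (((((Φ j t p) : ℝ) : ℂ) * (((β * (L : ℝ) ^ 2 : ℝ) : ℂ) * propCT L M β μ K p)) * ((((Wd t p') : ℝ) : ℂ) * (((β * (L : ℝ) ^ 2 : ℝ) : ℂ) * propCT L M β μ K p')) +
            ((((Wd t p) : ℝ) : ℂ) * (((β * (L : ℝ) ^ 2 : ℝ) : ℂ) * propCT L M β μ K p)) * ((((Φ j t p') : ℝ) : ℂ) * (((β * (L : ℝ) ^ 2 : ℝ) : ℂ) * propCT L M β μ K p'))) *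
            F p σ p'
        else 0)‖ ≤ (2 : ℝ) ^ 11 * 15367 * Finf := by
  classical
  have hβ0 : 0 < β := pos_of_klBetaMin_le hβ
  have hL : (0 : ℝ) < L := hβ0.trans_le hβL
  have hβL2 : 0 < β * (L : ℝ) ^ 2 := by positivity
  have hΛn : 0 < klScale klE0 n := klth_klScale_pos n
  have h10 := (klmf_klScale_succ_pos_le n).2
  have h1 := (klmf_klScale_succ_pos_le n).1
  have hmem := klws_affine_mem_Icc h10 ht
  set Λt : ℝ := klScale klE0 n + t * (klScale klE0 (n + 1) - klScale klE0 n) with hΛt_def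
  have hΛt : 0 < Λt := h1.trans_le hmem.1
  have hdiff : 0 ≤ klScale klE0 n - klScale klE0 (n + 1) := by linarith
  have hC : 0 ≤ (klScale klE0 n - klScale klE0 (n + 1)) * ((β * (L : ℝ) ^ 2) ^ 3)⁻¹ := by positivity
  set q : TorusSite 2 L := x - y with hq_def
  set hard : FreqMomentum L M → ℂ := fun p => (((Wd t p) : ℝ) : ℂ) * (((β * (L : ℝ) ^ 2 : ℝ) : ℂ) * propCT L M β μ K p) with hhard_def
  set soft : FreqMomentum L M → ℂ := fun p => (((Φ j t p) : ℝ) : ℂ) * (((β * (L : ℝ) ^ 2 : ℝ) : ℂ) * propCT L M β μ K p) with hsoft_def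
  have hn : ‖(((β * (L : ℝ) ^ 2 : ℝ) : ℂ))‖ = β * (L : ℝ) ^ 2 := by rw [Complex.norm_real, Real.norm_of_nonneg hβL2.le]
  have hH : ∀ p : FreqMomentum L M, ‖hard p‖ ≤ β * (L : ℝ) ^ 2 * (128 / 3 / Λt ^ 2) := by
    intro p
    have h : |Wd t p| * ‖propCT L M β μ K p‖ ≤ 128 / 3 / Λt ^ 2 := by
      rw [hWd]; exact abs_derivWeight_mul_norm_propCT_le β μ K hΛt p
    have hp' : hard p = (((Wd t p) : ℝ) : ℂ) * (((β * (L : ℝ) ^ 2 : ℝ) : ℂ) * propCT L M β μ K p) := rfl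
    rw [hp', norm_mul, norm_mul, hn, Complex.norm_real, Real.norm_eq_abs]
    calc |Wd t p| * (β * (L : ℝ) ^ 2 * ‖propCT L M β μ K p‖) = β * (L : ℝ) ^ 2 * (|Wd t p| * ‖propCT L M β μ K p‖) := by ring
      _ ≤ β * (L : ℝ) ^ 2 * (128 / 3 / Λt ^ 2) := mul_le_mul_of_nonneg_left h hβL2.le
  have hsoftn : ∀ p : FreqMomentum L M, ‖soft p‖ = β * (L : ℝ) ^ 2 * (|Φ j t p| * ‖propCT L M β μ K p‖) := by
    intro p
    have hp' : soft p = (((Φ j t p) : ℝ) : ℂ) * (((β * (L : ℝ) ^ 2 : ℝ) : ℂ) * propCT L M β μ K p) := rfl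
    rw [hp', norm_mul, norm_mul, hn, Complex.norm_real, Real.norm_eq_abs]; ring
  have hΦmem : ∀ k, 0 ≤ Φ j t k ∧ Φ j t k ≤ 1 - hubbardCutoffWeightCT L M β μ K (klScale klE0 n) k := by
    intro k
    have h := klmf_runningSymbol_mem L M β μ K n (isSoftSymbol_compl (L := L) (M := M) β μ K hj).1 ht k
    rw [hΦ]; exact h
  have hS : ∑ p : FreqMomentum L M, ‖soft p‖ ≤ β * (L : ℝ) ^ 2 * (15367 * klScale klE0 n * β * (L : ℝ) ^ 2) := by
    calc ∑ p : FreqMomentum L M, ‖soft p‖ = β * (L : ℝ) ^ 2 * ∑ k : FreqMomentum L M, |Φ j t k| * ‖propCT L M β μ K k‖ := by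
          rw [Finset.mul_sum]; exact sum_congr rfl fun p _ => hsoftn p
      _ ≤ β * (L : ℝ) ^ 2 * (15367 * klScale klE0 n * β * (L : ℝ) ^ 2) :=
          mul_le_mul_of_nonneg_left (sum_softSymbol_mul_norm_propCT_le_of_frameOK β μ K hK hβ hβL n hΦmem) hβL2.le
  have hS' : ∑ p : FreqMomentum L M, ‖soft (p.1, p.2 + q)‖ ≤ β * (L : ℝ) ^ 2 * (15367 * klScale klE0 n * β * (L : ℝ) ^ 2) := by
    rw [klph_sum_mshift_norm_reindex q (fun p => ‖soft p‖)]; exact hS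
  -- collapse and rename
  rw [klph_directRow_eq β μ K (Φ j t) (Wd t) F c x y]
  have e1 : ∀ p : FreqMomentum L M, ((p.1, p.2 + x - y) : FreqMomentum L M) = (p.1, p.2 + q) := fun p => by rw [hq_def, add_sub_assoc]
  simp only [e1]
  have hgoal : (∑ p : FreqMomentum L M, ∑ σ : Fin 2,
        (((((Φ j t p) : ℝ) : ℂ) * (((β * (L : ℝ) ^ 2 : ℝ) : ℂ) * propCT L M β μ K p)) *
              ((((Wd t (p.1, p.2 + q)) : ℝ) : ℂ) * (((β * (L : ℝ) ^ 2 : ℝ) : ℂ) * propCT L M β μ K (p.1, p.2 + q))) +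
            ((((Wd t p) : ℝ) : ℂ) * (((β * (L : ℝ) ^ 2 : ℝ) : ℂ) * propCT L M β μ K p)) *
              ((((Φ j t (p.1, p.2 + q)) : ℝ) : ℂ) * (((β * (L : ℝ) ^ 2 : ℝ) : ℂ) * propCT L M β μ K (p.1, p.2 + q)))) *
          F p σ (p.1, p.2 + q)) =
      ∑ p : FreqMomentum L M, ∑ σ : Fin 2, (soft p * hard (p.1, p.2 + q) + hard p * soft (p.1, p.2 + q)) * F p σ (p.1, p.2 + q) := by
    rfl
  rw [hgoal]
  set H0 : ℝ := β * (L : ℝ) ^ 2 * (128 / 3 / Λt ^ 2) with hH0_def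
  set SB : ℝ := β * (L : ℝ) ^ 2 * (15367 * klScale klE0 n * β * (L : ℝ) ^ 2) with hSB_def
  have hpt : ∀ (p : FreqMomentum L M) (σ : Fin 2),
      ‖(soft p * hard (p.1, p.2 + q) + hard p * soft (p.1, p.2 + q)) * F p σ (p.1, p.2 + q)‖ ≤ H0 * Finf * ‖soft p‖ + H0 * Finf * ‖soft (p.1, p.2 + q)‖ := by
    intro p σ
    rw [norm_mul]
    have hA : ‖soft p * hard (p.1, p.2 + q)‖ ≤ ‖soft p‖ * H0 := by rw [norm_mul]; exact mul_le_mul_of_nonneg_left (hH _) (norm_nonneg _)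
    have hB : ‖hard p * soft (p.1, p.2 + q)‖ ≤ H0 * ‖soft (p.1, p.2 + q)‖ := by rw [norm_mul]; exact mul_le_mul_of_nonneg_right (hH _) (norm_nonneg _)
    have hsum := (norm_add_le _ _).trans (add_le_add hA hB)
    calc ‖soft p * hard (p.1, p.2 + q) + hard p * soft (p.1, p.2 + q)‖ * ‖F p σ (p.1, p.2 + q)‖
        ≤ (‖soft p‖ * H0 + H0 * ‖soft (p.1, p.2 + q)‖) * Finf := mul_le_mul hsum (hF _ _ _) (norm_nonneg _) (by positivity)
      _ = H0 * Finf * ‖soft p‖ + H0 * Finf * ‖soft (p.1, p.2 + q)‖ := by ring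
  have htot : ‖∑ p : FreqMomentum L M, ∑ σ : Fin 2, (soft p * hard (p.1, p.2 + q) + hard p * soft (p.1, p.2 + q)) * F p σ (p.1, p.2 + q)‖ ≤
      2 * (H0 * Finf * SB + H0 * Finf * SB) := by
    calc ‖∑ p : FreqMomentum L M, ∑ σ : Fin 2, (soft p * hard (p.1, p.2 + q) + hard p * soft (p.1, p.2 + q)) * F p σ (p.1, p.2 + q)‖
        ≤ ∑ p : FreqMomentum L M, ‖∑ σ : Fin 2, (soft p * hard (p.1, p.2 + q) + hard p * soft (p.1, p.2 + q)) * F p σ (p.1, p.2 + q)‖ := norm_sum_le _ _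
      _ ≤ ∑ p : FreqMomentum L M, ∑ σ : Fin 2, ‖(soft p * hard (p.1, p.2 + q) + hard p * soft (p.1, p.2 + q)) * F p σ (p.1, p.2 + q)‖ :=
          sum_le_sum fun p _ => norm_sum_le _ _
      _ ≤ ∑ p : FreqMomentum L M, ∑ _σ : Fin 2, (H0 * Finf * ‖soft p‖ + H0 * Finf * ‖soft (p.1, p.2 + q)‖) :=
          sum_le_sum fun p _ => sum_le_sum fun σ _ => hpt p σ
      _ = 2 * (H0 * Finf * ∑ p : FreqMomentum L M, ‖soft p‖ + H0 * Finf * ∑ p : FreqMomentum L M, ‖soft (p.1, p.2 + q)‖) := by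
          simp only [sum_const, Finset.card_univ, Fintype.card_fin, nsmul_eq_mul, Nat.cast_ofNat]
          rw [← Finset.mul_sum, sum_add_distrib, Finset.mul_sum, Finset.mul_sum]
      _ ≤ 2 * (H0 * Finf * SB + H0 * Finf * SB) := by
          have h1 := mul_le_mul_of_nonneg_left hS (by positivity : 0 ≤ H0 * Finf)
          have h2 := mul_le_mul_of_nonneg_left hS' (by positivity : 0 ≤ H0 * Finf)
          linarith
  calc (klScale klE0 n - klScale klE0 (n + 1)) * ((β * (L : ℝ) ^ 2) ^ 3)⁻¹ *
        ‖∑ p : FreqMomentum L M, ∑ σ : Fin 2, (soft p * hard (p.1, p.2 + q) + hard p * soft (p.1, p.2 + q)) * F p σ (p.1, p.2 + q)‖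
      ≤ (klScale klE0 n - klScale klE0 (n + 1)) * ((β * (L : ℝ) ^ 2) ^ 3)⁻¹ * (2 * (H0 * Finf * SB + H0 * Finf * SB)) := mul_le_mul_of_nonneg_left htot hC
    _ = 4 * (128 / 3) * 15367 * ((klScale klE0 n - klScale klE0 (n + 1)) * klScale klE0 n / Λt ^ 2) * Finf := by
        rw [hH0_def, hSB_def]; field_simp; ring
    _ ≤ 4 * (128 / 3) * 15367 * 12 * Finf := by
        have := klph_slice_ratio_le'' n ht
        have h0 : (0 : ℝ) ≤ 4 * (128 / 3) * 15367 := by norm_num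
        nlinarith [mul_le_mul_of_nonneg_left this h0]
    _ = (2 : ℝ) ^ 11 * 15367 * Finf := by norm_num

/-- **RQ SIGN-BLIND IN THE ROWS DOOR'S SHAPE** (any `Qm x y`): on an admissible frame, `klBetaMin ≤ β ≤ L`, member `j ≥ n+1`, `t ∈ [0,1]`, with the Matsubara shifts `σ`/`τ`,
for any partner kernel `F` with `‖F p p′‖ ≤ F∞`:
`(Λₙ−Λₙ₊₁)((βL²)³)⁻¹‖Σ_pΣ_{p′}[p′.1 + 2ω₀ + 1 = p.1 ∧ p′.2 = p.2 + Qm − x − y]·((Φ_jβL²ĝ)(p)(Ẇ_tβL²ĝ)(p′) + (Ẇ_tβL²ĝ)(p)(Φ_jβL²ĝ)(p′))·F p p′‖ ≤ 2¹⁰·15367·F∞` (no hypothesis on `M`).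
[cite: BenfattoGiulianiMastropietro2006, §2.4–§2.5] -/
theorem klph_exchangeRow_signBlind_le {β μ : ℝ} {K : TrigPolyC4v} (hK : FrameOK R U N μ K) (hβ : klBetaMin ≤ β) (hβL : β ≤ L)
    (n : ℕ) {t : ℝ} (ht : t ∈ Icc (0 : ℝ) 1)
    (Φ : ℕ → ℝ → FreqMomentum L M → ℝ) (hΦ : Φ = fun j t k => (softSymbolCompl L M β μ K (n + 1) j) k + (hubbardCutoffWeightCT L M β μ K (klScale klE0 (n + 1)) k -
            hubbardCutoffWeightCT L M β μ K (klScale klE0 n + t * (klScale klE0 (n + 1) - klScale klE0 n)) k))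
    (Wd : ℝ → FreqMomentum L M → ℝ) (hWd : Wd = fun t k => deriv (fun Λ' : ℝ => hubbardCutoffWeightCT L M β μ K Λ' k) (klScale klE0 n + t * (klScale klE0 (n + 1) - klScale klE0 n)))
    {j : ℕ} (hj : n + 1 ≤ j)
    {σ τ : MatsubaraIdx M → MatsubaraIdx M}
    (hσ : ∀ ν : MatsubaraIdx M, (ν : ℕ) ≠ 0 → matsubaraInt M (σ ν) = matsubaraInt M ν - 1)
    (hτ : ∀ ν : MatsubaraIdx M, (ν : ℕ) ≠ 2 * M - 1 → matsubaraInt M (τ ν) = matsubaraInt M ν + 1)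
    (F : FreqMomentum L M → FreqMomentum L M → ℂ) {Finf : ℝ} (hF0 : 0 ≤ Finf) (hF : ∀ p p' : FreqMomentum L M, ‖F p p'‖ ≤ Finf)
    (Qm x y : TorusSite 2 L) :
    (klScale klE0 n - klScale klE0 (n + 1)) * ((β * (L : ℝ) ^ 2) ^ 3)⁻¹ *
      ‖∑ p : FreqMomentum L M, ∑ p' : FreqMomentum L M,
        (if matsubaraInt M p'.1 + matsubaraInt M (omega0 M) + matsubaraInt M (omega0 M) + 1 = matsubaraInt M p.1 ∧ p'.2 = p.2 + Qm - x - y then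
          (((((Φ j t p) : ℝ) : ℂ) * (((β * (L : ℝ) ^ 2 : ℝ) : ℂ) * propCT L M β μ K p)) * ((((Wd t p') : ℝ) : ℂ) * (((β * (L : ℝ) ^ 2 : ℝ) : ℂ) * propCT L M β μ K p')) +
            ((((Wd t p) : ℝ) : ℂ) * (((β * (L : ℝ) ^ 2 : ℝ) : ℂ) * propCT L M β μ K p)) * ((((Φ j t p') : ℝ) : ℂ) * (((β * (L : ℝ) ^ 2 : ℝ) : ℂ) * propCT L M β μ K p'))) *
            F p p'
        else 0)‖ ≤ (2 : ℝ) ^ 10 * 15367 * Finf := by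
  classical
  have hβ0 : 0 < β := pos_of_klBetaMin_le hβ
  have hL : (0 : ℝ) < L := hβ0.trans_le hβL
  have hβL2 : 0 < β * (L : ℝ) ^ 2 := by positivity
  have hΛn : 0 < klScale klE0 n := klth_klScale_pos n
  have h10 := (klmf_klScale_succ_pos_le n).2
  have h1 := (klmf_klScale_succ_pos_le n).1
  have hmem := klws_affine_mem_Icc h10 ht
  set Λt : ℝ := klScale klE0 n + t * (klScale klE0 (n + 1) - klScale klE0 n) with hΛt_def
  have hΛt : 0 < Λt := h1.trans_le hmem.1
  have hdiff : 0 ≤ klScale klE0 n - klScale klE0 (n + 1) := by linarith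
  have hC : 0 ≤ (klScale klE0 n - klScale klE0 (n + 1)) * ((β * (L : ℝ) ^ 2) ^ 3)⁻¹ := by positivity
  set r : TorusSite 2 L := Qm - x - y with hr_def
  set hard : FreqMomentum L M → ℂ := fun p => (((Wd t p) : ℝ) : ℂ) * (((β * (L : ℝ) ^ 2 : ℝ) : ℂ) * propCT L M β μ K p) with hhard_def
  set soft : FreqMomentum L M → ℂ := fun p => (((Φ j t p) : ℝ) : ℂ) * (((β * (L : ℝ) ^ 2 : ℝ) : ℂ) * propCT L M β μ K p) with hsoft_def
  have hn : ‖(((β * (L : ℝ) ^ 2 : ℝ) : ℂ))‖ = β * (L : ℝ) ^ 2 := by rw [Complex.norm_real, Real.norm_of_nonneg hβL2.le]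
  have hH : ∀ p : FreqMomentum L M, ‖hard p‖ ≤ β * (L : ℝ) ^ 2 * (128 / 3 / Λt ^ 2) := by
    intro p
    have h : |Wd t p| * ‖propCT L M β μ K p‖ ≤ 128 / 3 / Λt ^ 2 := by
      rw [hWd]; exact abs_derivWeight_mul_norm_propCT_le β μ K hΛt p
    have hp' : hard p = (((Wd t p) : ℝ) : ℂ) * (((β * (L : ℝ) ^ 2 : ℝ) : ℂ) * propCT L M β μ K p) := rfl
    rw [hp', norm_mul, norm_mul, hn, Complex.norm_real, Real.norm_eq_abs]
    calc |Wd t p| * (β * (L : ℝ) ^ 2 * ‖propCT L M β μ K p‖) = β * (L : ℝ) ^ 2 * (|Wd t p| * ‖propCT L M β μ K p‖) := by ring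
      _ ≤ β * (L : ℝ) ^ 2 * (128 / 3 / Λt ^ 2) := mul_le_mul_of_nonneg_left h hβL2.le
  have hsoftn : ∀ p : FreqMomentum L M, ‖soft p‖ = β * (L : ℝ) ^ 2 * (|Φ j t p| * ‖propCT L M β μ K p‖) := by
    intro p
    have hp' : soft p = (((Φ j t p) : ℝ) : ℂ) * (((β * (L : ℝ) ^ 2 : ℝ) : ℂ) * propCT L M β μ K p) := rfl
    rw [hp', norm_mul, norm_mul, hn, Complex.norm_real, Real.norm_eq_abs]; ring
  have hΦmem : ∀ k, 0 ≤ Φ j t k ∧ Φ j t k ≤ 1 - hubbardCutoffWeightCT L M β μ K (klScale klE0 n) k := by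
    intro k
    have h := klmf_runningSymbol_mem L M β μ K n (isSoftSymbol_compl (L := L) (M := M) β μ K hj).1 ht k
    rw [hΦ]; exact h
  have hS : ∑ p : FreqMomentum L M, ‖soft p‖ ≤ β * (L : ℝ) ^ 2 * (15367 * klScale klE0 n * β * (L : ℝ) ^ 2) := by
    calc ∑ p : FreqMomentum L M, ‖soft p‖ = β * (L : ℝ) ^ 2 * ∑ k : FreqMomentum L M, |Φ j t k| * ‖propCT L M β μ K k‖ := by
          rw [Finset.mul_sum]; exact sum_congr rfl fun p _ => hsoftn p
      _ ≤ β * (L : ℝ) ^ 2 * (15367 * klScale klE0 n * β * (L : ℝ) ^ 2) :=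
          mul_le_mul_of_nonneg_left (sum_softSymbol_mul_norm_propCT_le_of_frameOK β μ K hK hβ hβL n hΦmem) hβL2.le
  -- the doubly reindexed soft sum
  have hS' : (∑ p : FreqMomentum L M, if (p.1 : ℕ) = 0 then (0 : ℝ) else ‖soft (σ p.1, p.2 + r)‖) ≤ ∑ q : FreqMomentum L M, ‖soft q‖ := by
    rw [klph_sum_shift_reindex_real (L := L) hσ hτ (fun q => ‖soft (q.1, q.2 + r)‖)]
    calc (∑ q : FreqMomentum L M, if (q.1 : ℕ) = 2 * M - 1 then (0 : ℝ) else ‖soft (q.1, q.2 + r)‖)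
        ≤ ∑ q : FreqMomentum L M, ‖soft (q.1, q.2 + r)‖ := by
          refine sum_le_sum fun q _ => ?_
          split_ifs
          · exact norm_nonneg _
          · exact le_rfl
      _ = ∑ q : FreqMomentum L M, ‖soft q‖ := klph_sum_mshift_norm_reindex r (fun q => ‖soft q‖)
  -- collapse and rename
  rw [klph_exchangeRow_eq (L := L) hσ β μ K (Φ j t) (Wd t) F Qm x y]
  have e1 : ∀ p : FreqMomentum L M, ((σ p.1, p.2 + Qm - x - y) : FreqMomentum L M) = (σ p.1, p.2 + r) := fun p => by
    rw [hr_def, add_sub_assoc, add_sub_assoc]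
  simp only [e1]
  have hgoal : (∑ p : FreqMomentum L M, if (p.1 : ℕ) = 0 then 0 else
        (((((Φ j t p) : ℝ) : ℂ) * (((β * (L : ℝ) ^ 2 : ℝ) : ℂ) * propCT L M β μ K p)) *
              ((((Wd t (σ p.1, p.2 + r)) : ℝ) : ℂ) * (((β * (L : ℝ) ^ 2 : ℝ) : ℂ) * propCT L M β μ K (σ p.1, p.2 + r))) +
            ((((Wd t p) : ℝ) : ℂ) * (((β * (L : ℝ) ^ 2 : ℝ) : ℂ) * propCT L M β μ K p)) *
              ((((Φ j t (σ p.1, p.2 + r)) : ℝ) : ℂ) * (((β * (L : ℝ) ^ 2 : ℝ) : ℂ) * propCT L M β μ K (σ p.1, p.2 + r)))) *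
          F p (σ p.1, p.2 + r)) =
      ∑ p : FreqMomentum L M, if (p.1 : ℕ) = 0 then 0 else (soft p * hard (σ p.1, p.2 + r) + hard p * soft (σ p.1, p.2 + r)) * F p (σ p.1, p.2 + r) := by
    rfl
  rw [hgoal]
  set H0 : ℝ := β * (L : ℝ) ^ 2 * (128 / 3 / Λt ^ 2) with hH0_def
  have hpt : ∀ p : FreqMomentum L M,
      ‖(if (p.1 : ℕ) = 0 then 0 else (soft p * hard (σ p.1, p.2 + r) + hard p * soft (σ p.1, p.2 + r)) * F p (σ p.1, p.2 + r))‖ ≤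
        H0 * Finf * ‖soft p‖ + H0 * Finf * (if (p.1 : ℕ) = 0 then (0 : ℝ) else ‖soft (σ p.1, p.2 + r)‖) := by
    intro p
    by_cases hp : (p.1 : ℕ) = 0
    · rw [if_pos hp, if_pos hp, norm_zero, mul_zero, add_zero]; positivity
    · rw [if_neg hp, if_neg hp, norm_mul]
      have hA : ‖soft p * hard (σ p.1, p.2 + r)‖ ≤ ‖soft p‖ * H0 := by
        rw [norm_mul]; exact mul_le_mul_of_nonneg_left (hH _) (norm_nonneg _)
      have hB : ‖hard p * soft (σ p.1, p.2 + r)‖ ≤ H0 * ‖soft (σ p.1, p.2 + r)‖ := by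
        rw [norm_mul]; exact mul_le_mul_of_nonneg_right (hH _) (norm_nonneg _)
      have hsum := (norm_add_le _ _).trans (add_le_add hA hB)
      calc ‖soft p * hard (σ p.1, p.2 + r) + hard p * soft (σ p.1, p.2 + r)‖ * ‖F p (σ p.1, p.2 + r)‖
          ≤ (‖soft p‖ * H0 + H0 * ‖soft (σ p.1, p.2 + r)‖) * Finf := mul_le_mul hsum (hF _ _) (norm_nonneg _) (by positivity)
        _ = H0 * Finf * ‖soft p‖ + H0 * Finf * ‖soft (σ p.1, p.2 + r)‖ := by ring
  have htot : ‖∑ p : FreqMomentum L M, (if (p.1 : ℕ) = 0 then 0 else (soft p * hard (σ p.1, p.2 + r) + hard p * soft (σ p.1, p.2 + r)) * F p (σ p.1, p.2 + r))‖ ≤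
      2 * (H0 * Finf) * (β * (L : ℝ) ^ 2 * (15367 * klScale klE0 n * β * (L : ℝ) ^ 2)) := by
    calc ‖∑ p : FreqMomentum L M, (if (p.1 : ℕ) = 0 then 0 else (soft p * hard (σ p.1, p.2 + r) + hard p * soft (σ p.1, p.2 + r)) * F p (σ p.1, p.2 + r))‖
        ≤ ∑ p : FreqMomentum L M, ‖(if (p.1 : ℕ) = 0 then 0 else (soft p * hard (σ p.1, p.2 + r) + hard p * soft (σ p.1, p.2 + r)) * F p (σ p.1, p.2 + r))‖ :=
          norm_sum_le _ _
      _ ≤ ∑ p : FreqMomentum L M, (H0 * Finf * ‖soft p‖ + H0 * Finf * (if (p.1 : ℕ) = 0 then (0 : ℝ) else ‖soft (σ p.1, p.2 + r)‖)) :=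
          sum_le_sum fun p _ => hpt p
      _ = H0 * Finf * ∑ p : FreqMomentum L M, ‖soft p‖ +
            H0 * Finf * ∑ p : FreqMomentum L M, (if (p.1 : ℕ) = 0 then (0 : ℝ) else ‖soft (σ p.1, p.2 + r)‖) := by
          rw [sum_add_distrib, Finset.mul_sum, Finset.mul_sum]
      _ ≤ H0 * Finf * (β * (L : ℝ) ^ 2 * (15367 * klScale klE0 n * β * (L : ℝ) ^ 2)) +
            H0 * Finf * (β * (L : ℝ) ^ 2 * (15367 * klScale klE0 n * β * (L : ℝ) ^ 2)) :=
          add_le_add (mul_le_mul_of_nonneg_left hS (by positivity)) (mul_le_mul_of_nonneg_left (hS'.trans hS) (by positivity))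
      _ = _ := by ring
  calc (klScale klE0 n - klScale klE0 (n + 1)) * ((β * (L : ℝ) ^ 2) ^ 3)⁻¹ *
        ‖∑ p : FreqMomentum L M, (if (p.1 : ℕ) = 0 then 0 else (soft p * hard (σ p.1, p.2 + r) + hard p * soft (σ p.1, p.2 + r)) * F p (σ p.1, p.2 + r))‖
      ≤ (klScale klE0 n - klScale klE0 (n + 1)) * ((β * (L : ℝ) ^ 2) ^ 3)⁻¹ *
          (2 * (H0 * Finf) * (β * (L : ℝ) ^ 2 * (15367 * klScale klE0 n * β * (L : ℝ) ^ 2))) := mul_le_mul_of_nonneg_left htot hC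
    _ = 2 * (128 / 3) * 15367 * ((klScale klE0 n - klScale klE0 (n + 1)) * klScale klE0 n / Λt ^ 2) * Finf := by
        rw [hH0_def]; field_simp
    _ ≤ 2 * (128 / 3) * 15367 * 12 * Finf := by
        have := klph_slice_ratio_le'' n ht
        have h0 : (0 : ℝ) ≤ 2 * (128 / 3) * 15367 := by norm_num
        nlinarith [mul_le_mul_of_nonneg_left this h0]
    _ = (2 : ℝ) ^ 10 * 15367 * Finf := by norm_num

end Door

end Summit.HubbardSuperconductivity.HubbardSuperconductivity.Theorems.KLRegimeSplit

end
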